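import Summits.NavierStokesRegularity.FluidComputer.PalasekTowerRegisterGlobalDesign
import Summits.NavierStokesRegularity.FluidComputer.PalasekTowerHeredityWitnessUnconditional

/-!
# REGISTER v2.3′: the SINGLETON design class — the `EpisodeBaseG` split over ONE named schedule is lossless
# and closes by one certificate

Cell `ns-blowup`, seat `ns-blowup-ecbridge-4` (g2), one writer of the design-class shapes by planner RULING
STATUS l.1890; companion of `PalasekTowerRegisterGlobalDesign.lean` (p418872: `HostClass`,
`HostPreparationD D`, `FirstEpisodeD D`, the glue `episodeBaseG_of_host_firstD`, the re-push surgery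
`Schedule.repush` / `Stage.repushG`), `PalasekTowerRegisterGlobalDesignSlot.lean` (p419455: the
TOLERANCE constructors `HostClass.nearC1` / `HostClass.rising`) and of seat `ns-blowup-ecbridge-6` (g2)'s
`PalasekTowerHeredityWitnessUnconditional.lean` (a registered stage PINS the design's flow on its slab —
`Stage.velocity_eq'`, forced Serrin–Masuda, no W14 — and `Stage.nonempty_extends_of_levelWitness'`).
LABEL: E–C typing (KERNEL vocabulary: one class constructor + proved reductions). WHAT THIS IS NOT: not
Navier–Stokes evidence — no schedule, host, push or stage is constructed; nothing is asserted; NO design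
is named here (the tree's only registered level-`0` host so far, seat ecbridge-3's prescribed-path host,
is junk with respect to heredity by its author's own statement, STATUS l.2150).

## Why (planner RULINGS l.1890 / l.2052 (3) / l.2117 (3): «19179 stays one item until a CONCRETE class D₀ is named; is `FirstEpisodeD D₀` trap-free BY CONSTRUCTION and `HostPreparationD D₀` inhabited-in-principle?»)

A tolerance class on the readout STATE (`nearC1 𝒰 ε₀ ε₁ ⊓ rising κ`) cannot be certified trap-free in the
kernel: `rising κ` is met by pushed or instant-tangent junk hosts, and a `C¹`-neighbourhood keeps a `∀`
over hosts whose futures on the window are controlled only by an `ℝ³` stability theorem nobody has (this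
seat, STATUS 2026-08-26 «ANSWERS»). The class that IS certifiable is the SINGLETON: `HostClass.exact S₀`
admits exactly the hosts OF THE NAMED SCHEDULE `S₀` (datum, force, clock, ball). Because a registered
stage pins the design's classical flow on its slab (`Stage.velocity_eq'`), all hosts in the class share
one velocity — there are no foreign hosts — and:

* `hostPreparationD_exact_iff` — `HostPreparationD (exact S₀)` ↔ «`S₀` is pinned (`Λ = 8`, `θ = 6/5`),
  rigid, quiet and carries a globally anchored registered level-`0` stage» (what a prescribed-path
  construction à la ecbridge-3 proves for an explicit design);
* `firstEpisodeD_exact_of_levelWitness` — `FirstEpisodeD (exact S₀)` follows from ONE certificate: an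
  admissible re-push of `S₀` (new push constant `c ≤ c₁` and push `g`, equal to `S₀.f` on the host's slab,
  re-pushed schedule again pinned rigid quiet) whose re-pushed design carries a LEVEL WITNESS at level `0`
  (`Schedule.LevelWitness`: its own classical finite-energy flow from the Clay datum reaches `τ₁` below
  `c₂ Y₁` on the window and shows the three level-`1` floors) — no uniqueness hypothesis; the push-free
  corollary `firstEpisodeD_exact_of_levelWitness_self` (the design already carries its push);
* `FirstEpisodeD.exact_levelWitness` — the free converse; `episodeBaseG_iff_exists_exact` — the split of
  K1G over singleton classes is LOSSLESS: `EpisodeBaseG ↔ ∃ S₀, HostPreparationD (exact S₀) ∧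
  FirstEpisodeD (exact S₀)` (composition = the registered glue `episodeBaseG_of_host_firstD (exact S₀)`).

So the day a design `S₀` is NAMED, the honest children of item 19179 are the two one-liners over
`HostClass.exact S₀`; until then the item stays whole (R2).

References: S. Palasek, arXiv:2605.13827 §3.3–§4 [cite: Palasek2026ElementaryModel, §4]; H. Sohr, *The
Navier–Stokes equations*, Birkhäuser 2001, Ch. V Thm. 1.5.1 [cite: Sohr2001, Ch. V Thm. 1.5.1].
-/

noncomputable section

namespace Summit.NavierStokesRegularity.FluidComputer.PalasekTowerClayBridge

open Set MeasureTheory Filter Topology Function Real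
open scoped ENNReal ContDiff NNReal
open Literature.Analysis.FluidPDE

/-! ## §1 The singleton design class -/

/-- **The SINGLETON design class of a named schedule `S₀`**: a host `(S, s₀)` lies in it iff its
schedule IS `S₀` (same Clay datum, force, clock, constants, ball). All its hosts share one velocity on
`[0, τ 0]` (`HostClass.exact_velocity_eq`). [folklore] -/
def HostClass.exact (S₀ : Schedule TowerRates.wide) : HostClass := fun S _ => S = S₀

/-- **No foreign hosts in a singleton class**: two registered level-`0` stages of the same schedule
have the same velocity on the host's slab (a stage pins the design's flow; forced Serrin–Masuda, no
W14 — `Stage.velocity_eq'`). [cite: Sohr2001, Ch. V Thm. 1.5.1] -/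
theorem HostClass.exact_velocity_eq (S₀ : Schedule TowerRates.wide)
    (s₀ s₀' : Stage 1 TowerRates.wide S₀ (Margins.routeG TowerRates.wide) 0) :
    ∀ t ∈ Icc 0 (S₀.τ 0), s₀'.u t = s₀.u t :=
  Stage.velocity_eq' one_pos s₀ s₀'

/-- The singleton class is contained in the class of all hosts (so `FirstEpisodeAll` implies the first
episode over every singleton, `FirstEpisodeD.anti`). [folklore] -/
theorem HostClass.exact_le_any (S₀ : Schedule TowerRates.wide) :
    ∀ S s₀, HostClass.exact S₀ S s₀ → HostClass.any S s₀ :=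
  fun _ _ _ => trivial

/-! ## §2 Host preparation in the singleton class -/

/-- **Host preparation in the singleton class of `S₀` unfolds to the named design's own level-`0`
stage**: `S₀` is pinned (`Λ = 8`, `θ = 6/5`), rigid and quiet and carries a globally anchored
registered stage at level `0`. [folklore] -/
theorem hostPreparationD_exact_iff (S₀ : Schedule TowerRates.wide) :
    HostPreparationD (HostClass.exact S₀) ↔
      S₀.Pins 8 (6 / 5) ∧ S₀.Rigid ∧ S₀.Quiet ∧
        Nonempty (Stage 1 TowerRates.wide S₀ (Margins.routeG TowerRates.wide) 0) := by
  constructor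
  · rintro ⟨S, s₀, hP, hR, hQ, hD⟩
    have hS : S = S₀ := hD
    subst hS
    exact ⟨hP, hR, hQ, ⟨s₀⟩⟩
  · rintro ⟨hP, hR, hQ, ⟨s₀⟩⟩
    exact ⟨S₀, s₀, hP, hR, hQ, rfl⟩

/-- Host preparation in a singleton class is rung `0` witnessed by the named design. [folklore] -/
theorem HostPreparationD.rungG_zero_of_exact {S₀ : Schedule TowerRates.wide}
    (h : HostPreparationD (HostClass.exact S₀)) : RungG 0 :=
  h.rungG_zero

/-! ## §3 The first episode over the singleton class closes by ONE certificate (no uniqueness hypothesis) -/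

/-- **ONE CERTIFICATE CLOSES THE FIRST EPISODE OVER A SINGLETON CLASS.** Let `S₀` be a schedule on the
wide-base rates, `c ≤ c₁` a push constant and `g` an admissible push (Clay class, silent from `T`,
`‖g‖ ≤ c Y_k` on the growth windows) equal to `S₀.f` on `[0, τ 0] × ℝ³`, with the re-pushed schedule
`S₀.repush c hc g …` pinned (`Λ = 8`, `θ = 6/5`), rigid and quiet; suppose the RE-PUSHED DESIGN carries a
level witness at level `0` (its own classical finite-energy flow from the Clay datum reaches `τ 1` below
`c₂ Y₁` on `[τ 0, τ 1]` and shows at `τ 1`, in the ball, the speed floor `c₁ Y₁`, the strain floor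
`c₁ A₁` and the `N₁`-core loop). Then `FirstEpisodeD (HostClass.exact S₀)`: every host of `S₀` is
transported to the re-pushed schedule (`Stage.repushG`, same flow, slab force unchanged) and the witness
extends it there (`Stage.nonempty_extends_of_levelWitness'`: the stage pins the flow, the pressure is
re-gauged — forced Serrin–Masuda, no W14). [cite: Sohr2001, Ch. V Thm. 1.5.1] -/
theorem firstEpisodeD_exact_of_levelWitness {S₀ : Schedule TowerRates.wide} {c : ℝ} (hc : c ≤ S₀.c₁)
    {g : ℝ → EuclideanSpace ℝ (Fin 3) → EuclideanSpace ℝ (Fin 3)}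
    (h₁ : IsSmoothOnHalfSpace g) (h₂ : HasRapidSpaceTimeDecay g)
    (h₃ : ∀ t, S₀.T ≤ t → ∀ x, g t x = 0)
    (h₄ : ∀ k, ∀ t ∈ Icc (S₀.τ k) (S₀.τ (k + 1)), ∀ x, ‖g t x‖ ≤ c * TowerRates.wide.Y k)
    (hg : ∀ t ∈ Icc 0 (S₀.τ 0), ∀ x, g t x = S₀.f t x)
    (hP' : (S₀.repush c hc g h₁ h₂ h₃ h₄).Pins 8 (6 / 5)) (hR' : (S₀.repush c hc g h₁ h₂ h₃ h₄).Rigid)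
    (hQ' : (S₀.repush c hc g h₁ h₂ h₃ h₄).Quiet)
    (hW : (S₀.repush c hc g h₁ h₂ h₃ h₄).LevelWitness 1 0) :
    FirstEpisodeD (HostClass.exact S₀) := by
  intro S hP hR hQ s₀ hD
  have hS : S = S₀ := hD
  subst hS
  refine ⟨c, hc, g, h₁, h₂, h₃, h₄, hg, hP', hR', hQ', ?_⟩
  obtain ⟨s₁, hs₁⟩ :=
    (s₀.repushG c hc g h₁ h₂ h₃ h₄ hg).nonempty_extends_of_levelWitness' one_pos hW
  exact ⟨s₁, fun t ht => hs₁ t ht⟩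

/-- **The push-free corollary**: if the named design `S₀` is pinned, rigid and quiet and ALREADY carries
its push (no re-push: `c := S₀.c₄`, `g := S₀.f`, the re-pushed schedule is `S₀` by structure eta), one
level witness of `S₀` at level `0` gives `FirstEpisodeD (HostClass.exact S₀)`.
[cite: Sohr2001, Ch. V Thm. 1.5.1] -/
theorem firstEpisodeD_exact_of_levelWitness_self {S₀ : Schedule TowerRates.wide} (hP : S₀.Pins 8 (6 / 5))
    (hR : S₀.Rigid) (hQ : S₀.Quiet) (hW : S₀.LevelWitness 1 0) :
    FirstEpisodeD (HostClass.exact S₀) :=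
  firstEpisodeD_exact_of_levelWitness S₀.c₄_le S₀.force_smooth S₀.force_decay S₀.force_silent
    S₀.push_small (fun _ _ _ => rfl) hP hR hQ hW

/-- **The free converse**: the first episode over the singleton class of a pinned rigid quiet `S₀` with
a registered host hands back an admissible re-push of `S₀` whose re-pushed design carries a level
witness at level `0` (the level-`1` stage read as a witness, `Stage.levelWitness`). [folklore] -/
theorem FirstEpisodeD.exact_levelWitness {S₀ : Schedule TowerRates.wide}
    (h : FirstEpisodeD (HostClass.exact S₀)) (hP : S₀.Pins 8 (6 / 5)) (hR : S₀.Rigid) (hQ : S₀.Quiet)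
    (s₀ : Stage 1 TowerRates.wide S₀ (Margins.routeG TowerRates.wide) 0) :
    ∃ (c : ℝ) (hc : c ≤ S₀.c₁) (g : ℝ → EuclideanSpace ℝ (Fin 3) → EuclideanSpace ℝ (Fin 3))
      (h₁ : IsSmoothOnHalfSpace g) (h₂ : HasRapidSpaceTimeDecay g)
      (h₃ : ∀ t, S₀.T ≤ t → ∀ x, g t x = 0)
      (h₄ : ∀ k, ∀ t ∈ Icc (S₀.τ k) (S₀.τ (k + 1)), ∀ x, ‖g t x‖ ≤ c * TowerRates.wide.Y k),
      (∀ t ∈ Icc 0 (S₀.τ 0), ∀ x, g t x = S₀.f t x) ∧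
      (S₀.repush c hc g h₁ h₂ h₃ h₄).Pins 8 (6 / 5) ∧ (S₀.repush c hc g h₁ h₂ h₃ h₄).Rigid ∧
      (S₀.repush c hc g h₁ h₂ h₃ h₄).Quiet ∧ (S₀.repush c hc g h₁ h₂ h₃ h₄).LevelWitness 1 0 := by
  obtain ⟨c, hc, g, h₁, h₂, h₃, h₄, hg, hP', hR', hQ', s₁, -⟩ := h S₀ hP hR hQ s₀ rfl
  exact ⟨c, hc, g, h₁, h₂, h₃, h₄, hg, hP', hR', hQ', s₁.levelWitness⟩

/-! ## §4 The split of K1G over singleton classes is lossless -/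

/-- **The two children over a singleton class compose to K1G** (the registered glue
`episodeBaseG_of_host_firstD` at `D := HostClass.exact S₀`; explicit binders in the order
`HostPreparationD → FirstEpisodeD → EpisodeBaseG`). [folklore] -/
theorem episodeBaseG_of_exact (S₀ : Schedule TowerRates.wide) (hH : HostPreparationD (HostClass.exact S₀))
    (hF : FirstEpisodeD (HostClass.exact S₀)) : EpisodeBaseG :=
  episodeBaseG_of_host_firstD (HostClass.exact S₀) hH hF

/-- **K1G ⇔ some singleton class carries both children** (no hypothesis): forward, K1G's own schedule —
its level-`1` stage restricts to a host (`Stage.restrictOfAntitone`, the route margin is level-antitone)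
and is itself the level witness (`Stage.levelWitness`), no re-push needed
(`firstEpisodeD_exact_of_levelWitness_self`); backward, the glue. So filing item 19179 as the pair
`[HostPreparationD (exact S₀), FirstEpisodeD (exact S₀)]` for a NAMED `S₀` loses nothing and gains
nothing but the name. [cite: Sohr2001, Ch. V Thm. 1.5.1] -/
theorem episodeBaseG_iff_exists_exact :
    EpisodeBaseG ↔ ∃ S₀ : Schedule TowerRates.wide,
      HostPreparationD (HostClass.exact S₀) ∧ FirstEpisodeD (HostClass.exact S₀) := by
  constructor
  · rintro ⟨S, hP, hR, hQ, ⟨s₁⟩⟩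
    refine ⟨S, (hostPreparationD_exact_iff S).2 ⟨hP, hR, hQ,
      ⟨s₁.restrictOfAntitone (Margins.antitone_routeG TowerRates.wide) (Nat.zero_le 1)⟩⟩, ?_⟩
    exact firstEpisodeD_exact_of_levelWitness_self hP hR hQ s₁.levelWitness
  · rintro ⟨S₀, hH, hF⟩
    exact episodeBaseG_of_exact S₀ hH hF

/-- **Relation to the witness door of record** (seat ecbridge-6: `EpisodeBaseG ↔ ∃` prepared host with a
level-`0` witness): for a pinned rigid quiet `S₀` with a registered host, a level witness of `S₀` at
level `0` gives BOTH children over `HostClass.exact S₀`. [cite: Sohr2001, Ch. V Thm. 1.5.1] -/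
theorem exact_children_of_levelWitness {S₀ : Schedule TowerRates.wide} (hP : S₀.Pins 8 (6 / 5))
    (hR : S₀.Rigid) (hQ : S₀.Quiet)
    (hs : Nonempty (Stage 1 TowerRates.wide S₀ (Margins.routeG TowerRates.wide) 0))
    (hW : S₀.LevelWitness 1 0) :
    HostPreparationD (HostClass.exact S₀) ∧ FirstEpisodeD (HostClass.exact S₀) :=
  ⟨(hostPreparationD_exact_iff S₀).2 ⟨hP, hR, hQ, hs⟩,
    firstEpisodeD_exact_of_levelWitness_self hP hR hQ hW⟩

end Summit.NavierStokesRegularity.FluidComputer.PalasekTowerClayBridge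

end
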